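/-
Copyright (c) 2025 Kevin Buzzard. All rights reserved.
Released under Apache 2.0 license as described in the file LICENSE.
Authors: Kevin Buzzard, Andrew Yang, Matthew Jasper
-- (for the material from `FLT/DedekindDomain/Completion/BaseChange.lean`)
Copyright (c) 2025 Yaël Dillies. All rights reserved.
Released under Apache 2.0 license as described in the file LICENSE.
Authors: Yaël Dillies, Kevin Buzzard, Matthew Jasper
-- (for the material from `FLT/Mathlib/Algebra/Module/Submodule/Basic.lean`)
Copyright (c) 2026 Kevin Buzzard. All rights reserved.
Released under Apache 2.0 license as described in the file LICENSE.
Authors: Kevin Buzzard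
-- (for the material from `FLT/Mathlib/RingTheory/RamificationInertia/Basic.lean`)

Vendored into this tree (Lean v4.32.0 / Mathlib v4.32.0) from the FLT project,
ImperialCollegeLondon/FLT @ 071d16bb51e87165b4f4b5466f14051344bf426b (2026-08-18), Apache-2.0
[FLTProject2025]. Modifications: see the module docstring ("Provenance and modifications").
-/
import Mathlib.Algebra.Module.Submodule.Defs
import Mathlib.Algebra.Ring.Subring.Basic
import Mathlib.Algebra.Ring.Subsemiring.Basic
import Mathlib.RingTheory.DedekindDomain.Ideal.Lemmas
import Mathlib.RingTheory.Flat.FaithfullyFlat.Basic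
import Mathlib.RingTheory.PicardGroup
import Mathlib.RingTheory.RamificationInertia.Basic
import Mathlib.RingTheory.SimpleRing.Principal
import Mathlib.RingTheory.Valuation.Discrete.RankOne
import Mathlib.Topology.Algebra.Module.FiniteDimension
import Mathlib.Topology.Algebra.Valued.NormedValued
import Literature.NumberTheory.AdelicBaseChange.AdicCompletionDensity
import Literature.NumberTheory.AdelicBaseChange.IntegralClosureLocalization
import Literature.NumberTheory.AdelicBaseChange.SemialgHom
import Literature.NumberTheory.AdelicBaseChange.ModuleTopologyToolkit
import Literature.NumberTheory.AdelicBaseChange.RightActions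
import HarnessLib

/-!
# Base change of adic completions: `L ⊗[K] K_v ≃ₐ[L] ∏_{w ∣ v} L_w`, `B ⊗[A] 𝒪_v ≅ ∏_{w ∣ v} 𝒪_w`, `e·f = [L_w : K_v]`

Topic `NumberTheory/AdelicBaseChange` — file 6 of the ADELIC BASE-CHANGE PACKET and its FIRST
MILESTONE (FLT-INVENTORY §5.2 rows T1–T3): Cassels–Fröhlich, *Algebraic Number Theory*, Ch. II
(Cassels, *Global fields*) §10, Theorem, display (10.2) — «`k̄ ⊗_k K = ⊕_j K_j` algebraically and
topologically» — in the Dedekind-domain generality of the FLT project, whose Lean text this is.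
Needs files 1–5. Set-up ("AKLB"): `A` Dedekind with fraction field `K`, `L/K` finite, `B` the
integral closure of `A` in `L` (Dedekind, `Frac B = L`, `B/A` module-finite), `v` a nonzero prime of
`A`, `w ∣ v` the primes of `B` above it (`v.Extension B`, file 5).

* `IsDedekindDomain.HeightOneSpectrum.Extension.adicCompletionSemialgHom : K_v →ₛₐ[algebraMap K L] L_w`
  (continuous), with **`valued_adicCompletionSemialgHom` : `w(x) = v(x)^{e(w|v)}` on `K_v`** and
  `adicCompletionSemialgHom_image_adicCompletionIntegers` (`𝒪_v ↦ 𝒪_w`);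
* `adicCompletion.baseChange : L ⊗[K] K_v →ₐ[L] ∏_{w∣v} L_w` (`= semialgHomPi` base-changed),
  `baseChangeRight` (the `K_v`-algebra version), module topologies on both sides
  (`instIsModuleTopology`, `instIsModuleTopologyPi`), `baseChangeRight_surjective` (density of `L`
  in `∏ L_w` — weak approximation, file 1 — and closedness of the image),
  `baseChangeRight_isOpenQuotientMap`;
* the integral picture: `tensorAdicCompletionIntegersTo : B ⊗[A] 𝒪_v →ₗ L ⊗[K] K_v`, its range is
  clopen and equals the closure of `B`, `range_baseChange_comp_tensorAdicCompletionTo_eq_pi`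
  (image = `∏ 𝒪_w`), `adicCompletionIntegersRingHom : 𝒪_v →+* 𝒪_w`,
  `tensorAdicCompletionIntegersToAdicCompletion`;
* ramification is unchanged by completion: `liesOver_completionIdeal`,
  **`ramificationIdx_eq_ramificationIdx`, `inertiaDeg_eq_inertiaDeg`**, hence
  **`ramificationIdx_mul_inertiaDeg_eq_finrank : e(w|v) f(w|v) = [L_w : K_v]`** (T3) and
  `finrank_tensorProduct_adicCompletion_eq_finrank_pi_adicCompletion` (via `Σ e f = [L:K]`, file 5);
* **`adicCompletion.baseChange_bijective`**, **`baseChangeAlgEquiv : L ⊗[K] K_v ≃ₐ[L] ∏_{w∣v} L_w`**,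
  **`baseChangeContinuousAlgEquiv : … ≃A[L] …`** (T1), **`integerBaseChangeLinearEquiv :
  B ⊗[A] K_v ≃ₗ[B] ∏_{w∣v} L_w`** with **`integerBaseChangeLinearEquiv_bijOn`** (`B ⊗ 𝒪_v ↔ ∏ 𝒪_w`,
  T2), `integerSubmodule`, `adicCompletionIntegers.tensorCoe`;
* two small Mathlib add-ons FLT needs here: `Subring.toSubmodule`, and
  `Ideal.ramificationIdx_mul_inertiaDeg_eq_finrank_of_isLocalRing` (`e f = rank` for a local
  Dedekind base).

Everything is PROVED; no named facts. The headline isomorphisms carry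
`[cite: CasselsFrohlichANT1967, Ch. II §10 Theorem (10.2)]`; every other declaration carries the
provenance tag `[cite: FLTProject2025, <FLT file> · <FLT name>]` — the STATEMENTS are, verbatim,
those of the published FLT project (the gate's cited-only rule for `Literature/`); anonymous
instances carry a docstring only.

Relation to the tree (dictionary, FLT-INVENTORY §5.2 T1): `Literature/NumberTheory/Automorphic/AdeleBaseChange.lean`
has the MAP `adicCompletionOfLiesOver K L v w : K_v →+* L_w` (Mathlib `Completion.mapRingHom` of
`WithVal v → WithVal w`) with `valued_adicCompletionOfLiesOver`, the quadratic isomorphism lives in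
`Automorphic/QuadraticTensorBaseChange.lean` (`localTensorAlgEquiv`), and
`EllipticCurves/LocalRestrictionDegree.lean` has the inequality `[L_w : K_v] ≤ [L : K]`. FLT's
`adicCompletionSemialgHom` is the same completion map packaged as a semialgebra hom (the bridge
lemma `adicCompletionSemialgHom = adicCompletionOfLiesOver` as ring homs is left to the file that
first needs both; expected `rfl` up to `adicCompletion.equiv`). This file supplies the general
ISOMORPHISM the tree lacked.

## Provenance and modifications (Apache-2.0 §4)

Lean source: `FLT/Mathlib/Algebra/Module/Submodule/Basic.lean`, `FLT/Mathlib/RingTheory/RamificationInertia/Basic.lean`,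
`FLT/DedekindDomain/Completion/BaseChange.lean` of ImperialCollegeLondon/FLT at commit
`071d16bb51e8` (branch `main`, 2026-08-18; Lean v4.34.0-rc1 / Mathlib `274ed6d6`), concatenated in
import order, each in its own `section`. Modifications made here: (1) back-port to Mathlib v4.32.0
(FLT-INVENTORY §3.2 probe E rule table): `module`/`public import`/`@[expose] public section`
removed, `Set.mem_ofPred_eq` ↦ `Set.mem_setOf_eq`, `ite_eq_right h`/`dite_eq_right h` ↦
`if_neg h`/`dif_neg h`, `f.toAlgHom.domRestrict B` ↦ `f.toAlgHom.comp (IsScalarTower.toAlgHom A B C)`,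
one `AlgHom → LinearMap` coercion made explicit, and FLT's `IsFractionRing.finrank_eq` (newer Mathlib) replaced at
its one use by the pin's identical `Algebra.IsAlgebraic.finrank_of_isFractionRing`; (2) docstrings and provenance tags added to every
declaration; the original copyright headers are kept above.
NAMESPACES (CONVENTIONS §2, reviews p318962/p319167): FLT's ROOT-LEVEL declarations of this file — FLT's
`example` sanity checks only — are declared in the path namespace
`Literature.NumberTheory.AdelicBaseChange`, which is opened at the top of this and every later packet
file so that FLT's text applies unchanged; FLT's deliberate extensions of MATHLIB namespaces — here
`IsDedekindDomain.HeightOneSpectrum(.Extension, .adicCompletion, .adicCompletionIntegers, .adicValued)`,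
`Ideal`, `Subring`, `WithVal`, `WithZero` — keep their absolute names for dot notation, and each such
docstring says so. Short names are FLT's throughout, so that the later files of the packet, and an
eventual Mathlib bump absorbing FLT's upstreaming, need no renaming; none of them exists in Mathlib
v4.32.0 or in the tree.

## References
* J. W. S. Cassels, A. Fröhlich (eds.), *Algebraic Number Theory* (1967), Ch. II §10, Theorem (10.2); §11. [CasselsFrohlichANT1967]
* J.-P. Serre, *Local Fields*, GTM 67 (1979), Ch. II §3. [SerreLocalFields1979]
* K. Buzzard, R. Taylor et al., *FLT* (Lean 4 project), Imperial College London, 2025–. [FLTProject2025]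
-/

namespace Literature.NumberTheory.AdelicBaseChange
-- the packet namespace (CONVENTIONS §2): FLT-root declarations below live in it; it is opened here so
-- that FLT's cross-references between them and its Mathlib-namespace extensions resolve unchanged.
end Literature.NumberTheory.AdelicBaseChange

open Literature.NumberTheory.AdelicBaseChange

/-! ## From `FLT/Mathlib/Algebra/Module/Submodule/Basic.lean` -/

section

variable {R S : Type*} [Ring R]

/-- If `S` is a subring of `R`, then `S` can be viewed as an `S`-submodule of `R`.
(In Mathlib's namespace `Subring`: a deliberate extension under FLT's name, for dot notation and so
that the later packet files apply unchanged — CONVENTIONS §2.)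
[cite: FLTProject2025, FLT/Mathlib/Algebra/Module/Submodule/Basic.lean · Subring.toSubmodule] -/
def Subring.toSubmodule (S : Subring R) : Submodule S R where
  __ := S
  smul_mem' x y h := by
    rw [smul_def, smul_eq_mul]
    apply S.mul_mem (SetLike.coe_mem x) h

end

/-! ## From `FLT/Mathlib/RingTheory/RamificationInertia/Basic.lean` -/

section

namespace Ideal

-- `ramificationIdx_mul_inertiaDeg_of_isLocalRing` is deprecated
-- in Aug 2026 so we use a longer name
/-- The **fundamental identity** `e * f = [S : R]` for a local ring `S`, finite over a Dedekind
domain `R`, and `p` a nonzero maximal ideal of `R`.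
(In Mathlib's namespace `Ideal`: a deliberate extension under FLT's name, for dot notation and so
that the later packet files apply unchanged — CONVENTIONS §2.)
[cite: FLTProject2025, FLT/Mathlib/RingTheory/RamificationInertia/Basic.lean · Ideal.ramificationIdx_mul_inertiaDeg_eq_finrank_of_isLocalRing] -/
theorem ramificationIdx_mul_inertiaDeg_eq_finrank_of_isLocalRing
    {R : Type*} [CommRing R] [IsDedekindDomain R]
    (S : Type*) [CommRing S] [IsDedekindDomain S] [IsLocalRing S] [Algebra R S] [FaithfulSMul R S]
    [Module.Finite R S] {p : Ideal R} [p.IsMaximal] (hp0 : p ≠ ⊥) :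
    (IsLocalRing.maximalIdeal S).ramificationIdx R *
      (IsLocalRing.maximalIdeal S).inertiaDeg R = Module.finrank R S := by
  have : IsDomain R := .of_faithfulSMul R S
  have hmax : IsLocalRing.maximalIdeal S ∈ p.primesOver S := by
    rw [IsLocalRing.primesOver_eq S hp0]; rfl
  have : (IsLocalRing.maximalIdeal S).LiesOver p := hmax.2
  have heq (q : p.primesOver S) : q.1 = IsLocalRing.maximalIdeal S :=
    IsLocalRing.eq_maximalIdeal (q.2.1.isMaximal (ne_bot_of_mem_primesOver hp0 q.2))
  have : Subsingleton (p.primesOver S) := ⟨fun q q' ↦ Subtype.ext ((heq q).trans (heq q').symm)⟩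
  rw [← sum_ramification_inertia_eq_finrank p S,
    Fintype.sum_subsingleton _ (⟨IsLocalRing.maximalIdeal S, hmax⟩ : p.primesOver S)]

end Ideal

end

/-! ## From `FLT/DedekindDomain/Completion/BaseChange.lean` -/

section

open scoped WithZero Valued TensorProduct
open Valuation.IsRankOneDiscrete WithZero

/-!

The general "AKLB" set-up. `K` is the field of fractions of the Dedekind domain `A`,
`L/K` is a finite separable extension, and `B` is the integral closure of `A` in `L`.

-/

variable (A K L B : Type*) [CommRing A] [CommRing B] [Algebra A B] [Field K] [Field L]
    [Algebra A K] [IsFractionRing A K] [Algebra B L] [IsDedekindDomain A]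
    [Algebra K L] [Algebra A L] [IsScalarTower A B L] [IsScalarTower A K L]

section assumptions

variable [IsIntegralClosure B A L] [FiniteDimensional K L]

/-!

Under these hypotheses and `[Algebra.IsSeparable K L]`, we can prove the following:

`[IsDomain B]`
`[Algebra.IsIntegral A B]`
`[Module.Finite A B]`
`[IsDedekindDomain B]`
`[IsFractionRing B L]`

However none of these facts are available to typeclass inference because they all use
variables such as `K` which are not mentioned in the statement so are unfindable by
Lean 4's typeclass system. We thus introduce them as variables when needed.

-/
namespace Literature.NumberTheory.AdelicBaseChange

example : IsDomain B := by
  have foo : Function.Injective (algebraMap B L) := IsIntegralClosure.algebraMap_injective B A _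
  have bar : IsDomain L := inferInstance
  exact Function.Injective.isDomain _ foo -- exact? failed

example : Algebra.IsIntegral A B := IsIntegralClosure.isIntegral_algebra A L

example [IsDomain B] [Algebra.IsSeparable K L] : IsDedekindDomain B :=
  IsIntegralClosure.isDedekindDomain A K L B

example [IsDedekindDomain B] : IsFractionRing B L :=
  IsIntegralClosure.isFractionRing_of_finite_extension A K L B

example [Algebra.IsSeparable K L] : Module.Finite A B :=
  have := IsIntegralClosure.isNoetherian A K L B
  Module.IsNoetherian.finite A B
-- variable [Module.Finite A B] -- we'll need this later

example : FaithfulSMul A B := FaithfulSMul.of_field_isFractionRing A B K L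

end Literature.NumberTheory.AdelicBaseChange
-- variable [FaithfulSMul A B] -- we'll need this later

end assumptions

variable [Algebra.IsIntegral A B] [IsFractionRing B L] [IsDedekindDomain B]

namespace IsDedekindDomain.HeightOneSpectrum

variable (v : HeightOneSpectrum A) {A B}

/--
If we have an AKLB set-up, and `w` is a valuation on `L` extending `v` on `K`,
then `σ v w` is the ring homomorphism from (K with valuation v) to (L with valuation w).
More precisely, by (K with valuation v) we mean the
type synonym `WithVal (HeightOneSpectrum.valuation K v)`, which is `K` equipped with
the instance `Valued K Γ₀` coming from `v`. In particular this type synonym has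
a canonical valuation, topology, and uniform addive group structure. It is shown
that `σ v w` is continuous.
-/
local notation "σ" => fun v w => algebraMap (WithVal (HeightOneSpectrum.valuation K v))
    (WithVal (HeightOneSpectrum.valuation L w))

/-- The local base-change map `σ v w : WithVal (v.valuation K) → WithVal (w.valuation L)` (i.e. `K
→ L` with the `v`- and `w`-adic valuations, `w ∣ v`) is continuous.
(In Mathlib's namespace `IsDedekindDomain.HeightOneSpectrum.adicValued`: a deliberate extension
under FLT's name, for dot notation and so that the later packet files apply unchanged — CONVENTIONS §2.)
[cite: FLTProject2025, FLT/DedekindDomain/Completion/BaseChange.lean · IsDedekindDomain.HeightOneSpectrum.adicValued.continuous_algebraMap] -/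
lemma adicValued.continuous_algebraMap
   (w : HeightOneSpectrum B) (hvw : w.under A = v) :
    Continuous (σ v w) := by
  refine continuous_of_continuousAt_zero _ ?_
  rw [ContinuousAt, map_zero, (Valued.hasBasis_nhds_zero _ _).tendsto_iff
    (Valued.hasBasis_nhds_zero _ _)]
  intro γL _
  let e := w.asIdeal.ramificationIdx A
  -- push `γL` to `ℤᵐ⁰`
  let σL := WithVal.valueGroupOrderIso₀ (w.valuation L)
  let σw := valueGroup₀_equiv_withZeroMulInt (w.valuation L)
  let m : ℤᵐ⁰ := σw (σL γL)
  -- `ℤᵐ⁰` values in `K` exponentiate by `e` in `L` so take the `e`th root and pull back to `γK`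
  let σv := valueGroup₀_equiv_withZeroMulInt (v.valuation K)
  let σK := (WithVal.valueGroupOrderIso₀ (v.valuation K))
  let γK := σK.symm (σv.symm (exp (m.log / e)))
  have hγK : γK ≠ 0 := by simp [γK]
  use .mk0 _ hγK
  simp only [Units.val_mk0, Set.mem_setOf_eq, true_and]
  intro x hx
  rcases eq_or_ne x 0 with rfl | hx₀; · simp
  rw [σK.lt_symm_apply, ← (valueGroup₀_equiv_withZeroMulInt_strictMono _).lt_iff_lt] at hx
  -- `change` needed after bump to mathlib#34045
  change (valueGroup₀_equiv_withZeroMulInt (valuation K v))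
    (σK ((WithVal.valuation (valuation K v)).restrict x)) < _ at hx
  rw [WithVal.valueGroupOrderIso₀_restrict,
    valueGroup₀_equiv_withZeroMulInt_restrict_apply_of_surjective (v.valuation_surjective K),
    OrderMonoidIso.apply_symm_apply, ← log_lt_log (by simp_all) (by simp)] at hx
  rw [← σL.strictMono.lt_iff_lt]
  -- `change` needed after bump to mathlib#34045
  change σL ((WithVal.valuation (w.valuation L)).restrict ((algebraMap (WithVal (valuation K v))
    (WithVal (valuation L w))) x)) < _
  rw [WithVal.valueGroupOrderIso₀_restrict,
    ← (valueGroup₀_equiv_withZeroMulInt_strictMono _).lt_iff_lt,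
    valueGroup₀_equiv_withZeroMulInt_restrict_apply_of_surjective (w.valuation_surjective L),
    WithVal.algebraMap_left_apply, WithVal.algebraMap_right_apply, ← valuation_comap A,
    ← log_lt_log (by simp_all) (by simp), log_pow, nsmul_eq_mul, mul_comm]
  subst hvw
  apply Int.mul_lt_of_lt_ediv (mod_cast pos_of_ne_zero (ramificationIdx_ne_zero A B
    (algebraMap_injective_of_field_isFractionRing A B K L) w)) hx

namespace Extension

variable {v} (w : v.Extension B)

/-- The map `(R,v) → (S,w)` as a semialgebra map over `R → S` (which is the same map!).
(In Mathlib's namespace `WithVal`: a deliberate extension under FLT's name, for dot notation and so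
that the later packet files apply unchanged — CONVENTIONS §2.)
[cite: FLTProject2025, FLT/DedekindDomain/Completion/BaseChange.lean · WithVal.semialgebraMap] -/
@[simps!]
def _root_.WithVal.semialgebraMap {R S Γ₀ Γ₀' : Type*} [CommRing R]
    [CommRing S] [LinearOrderedCommGroupWithZero Γ₀] [LinearOrderedCommGroupWithZero Γ₀']
    [Algebra R S] (v : Valuation R Γ₀) (w : Valuation S Γ₀') :
    WithVal v →ₛₐ[algebraMap R S] WithVal w where
  __ := algebraMap (WithVal v) (WithVal w)
  map_smul' r x := by
    simp [WithVal.algebraMap_left_apply, WithVal.algebraMap_right_apply, Algebra.smul_def]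

/-- If w of L divides v of K, `underSemialgHom v w pf` is the canonical map `Kᵥ → L_w` lying
above `K → L`. Here we actually use the type synonyms `WithVal K` and `WithVal L`.
(In Mathlib's namespace `IsDedekindDomain.HeightOneSpectrum.Extension`: a deliberate extension
under FLT's name, for dot notation and so that the later packet files apply unchanged — CONVENTIONS §2.)
[cite: FLTProject2025, FLT/DedekindDomain/Completion/BaseChange.lean · IsDedekindDomain.HeightOneSpectrum.Extension.adicCompletionSemialgHom] -/
noncomputable def adicCompletionSemialgHom :
    v.adicCompletion K →ₛₐ[algebraMap K L] w.1.adicCompletion L :=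
  ((adicCompletion.algEquiv L w.1).symm.toAlgHom.toSemialgHom).comp <|
    (((WithVal.semialgebraMap (v.valuation K) (w.1.valuation L)).restrictScalars <|
        UniformSpace.Completion.mapSemialgHom _ <|
          adicValued.continuous_algebraMap K L v w.1 w.2).comp
      (adicCompletion.algEquiv K v).toAlgHom.toSemialgHom)

/-- The square with sides K → K_v → L_w and K → L → L_w commutes.
(In Mathlib's namespace `IsDedekindDomain.HeightOneSpectrum.Extension`: a deliberate extension
under FLT's name, for dot notation and so that the later packet files apply unchanged — CONVENTIONS §2.)
[cite: FLTProject2025, FLT/DedekindDomain/Completion/BaseChange.lean · IsDedekindDomain.HeightOneSpectrum.Extension.adicCompletionSemialgHom_coe] -/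
lemma adicCompletionSemialgHom_coe (x : WithVal (v.valuation K)) :
    w.adicCompletionSemialgHom K L x = algebraMap K L x.ofVal :=
  (w.adicCompletionSemialgHom K L).commutes _

/-- The map K_v → L_w is continuous.
(In Mathlib's namespace `IsDedekindDomain.HeightOneSpectrum.Extension`: a deliberate extension
under FLT's name, for dot notation and so that the later packet files apply unchanged — CONVENTIONS §2.)
[cite: FLTProject2025, FLT/DedekindDomain/Completion/BaseChange.lean · IsDedekindDomain.HeightOneSpectrum.Extension.adicCompletionSemialgHom_continuous] -/
lemma adicCompletionSemialgHom_continuous : Continuous (w.adicCompletionSemialgHom K L) :=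
  (adicCompletion.continuous_ofCompletion L w.1).comp
    (UniformSpace.Completion.continuous_map.comp (adicCompletion.continuous_toCompletion K v))

open WithZeroTopology in
/--
The local ramification index for the extension L_w/K_v is equal to the global ramification
index for the extension w/v. In other words, if x in K_v and i:K_v->L_w then w(i(x))=v(x)^e
where e is computed globally.
(In Mathlib's namespace `IsDedekindDomain.HeightOneSpectrum.Extension`: a deliberate extension
under FLT's name, for dot notation and so that the later packet files apply unchanged — CONVENTIONS §2.)
[cite: FLTProject2025, FLT/DedekindDomain/Completion/BaseChange.lean · IsDedekindDomain.HeightOneSpectrum.Extension.valued_adicCompletionSemialgHom] -/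
lemma valued_adicCompletionSemialgHom (x) :
    Valued.v (adicCompletionSemialgHom K L w x) = Valued.v x ^
      w.1.asIdeal.ramificationIdx A := by
  revert x
  apply funext_iff.mp
  symm
  apply (adicCompletion.ofCompletion_surjective K v).injective_comp_right
  apply UniformSpace.Completion.ext
  · exact ((Valued.continuous_valuation_of_surjective
      (v.valuedAdicCompletion_surjective K)).pow _).comp
      (adicCompletion.continuous_ofCompletion K v)
  · exact ((Valued.continuous_valuation_of_surjective (w.1.valuedAdicCompletion_surjective L)).comp
      (adicCompletionSemialgHom_continuous K L w)).comp
      (adicCompletion.continuous_ofCompletion K v)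
  intro a
  simp only [Function.comp_apply, adicCompletion.valued_ofCompletion,
    Valued.valuedCompletion_apply, w.2, adicCompletionSemialgHom_coe,
    WithVal.equiv_symm_apply, WithVal.valued_toVal, ← valuation_comap A K L B w.1 _]
  rw [WithVal.valued_toVal]

/-- The canonical map K_v → L_w sends 𝓞_v to 𝓞_w.
(In Mathlib's namespace `IsDedekindDomain.HeightOneSpectrum.Extension`: a deliberate extension
under FLT's name, for dot notation and so that the later packet files apply unchanged — CONVENTIONS §2.)
[cite: FLTProject2025, FLT/DedekindDomain/Completion/BaseChange.lean · IsDedekindDomain.HeightOneSpectrum.Extension.adicCompletionSemialgHom_image_adicCompletionIntegers] -/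
lemma adicCompletionSemialgHom_image_adicCompletionIntegers :
    w.adicCompletionSemialgHom K L '' (v.adicCompletionIntegers K) ⊆
      w.1.adicCompletionIntegers L := by
  rintro y ⟨x, hx, rfl⟩
  rw [SetLike.mem_coe, mem_adicCompletionIntegers] at hx ⊢
  rw [w.valued_adicCompletionSemialgHom K L]
  rwa [pow_le_one_iff]
  exact ramificationIdx_ne_zero A B (algebraMap_injective_of_field_isFractionRing A B K L) w.1

/-- The K_v-algebra structure on L_w when w | v. (In Mathlib's namespace `IsDedekindDomain.HeightOneSpectrum.Extension`: a deliberate extension under FLT's name, for dot notation and so that the later packet files apply unchanged — CONVENTIONS §2.) -/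
noncomputable
instance : Algebra (v.adicCompletion K) (w.1.adicCompletion L) :=
  (w.adicCompletionSemialgHom K L).toAlgebra

/-- The K_v-action on L_w is continuous. (In Mathlib's namespace `IsDedekindDomain.HeightOneSpectrum.Extension`: a deliberate extension under FLT's name, for dot notation and so that the later packet files apply unchanged — CONVENTIONS §2.) -/
instance : ContinuousSMul (adicCompletion K v) (adicCompletion L w.1) := by
  constructor
  have leftCts := w.adicCompletionSemialgHom_continuous K L
  exact Continuous.mul (Continuous.fst' leftCts) continuous_snd

end Extension

namespace adicCompletion

variable (B)

/-- The canonical map `K_v → ∏_{w|v} L_w` extending K → L.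
(In Mathlib's namespace `IsDedekindDomain.HeightOneSpectrum.adicCompletion`: a deliberate extension
under FLT's name, for dot notation and so that the later packet files apply unchanged — CONVENTIONS §2.)
[cite: FLTProject2025, FLT/DedekindDomain/Completion/BaseChange.lean · IsDedekindDomain.HeightOneSpectrum.adicCompletion.semialgHomPi] -/
noncomputable def semialgHomPi :
    v.adicCompletion K →ₛₐ[algebraMap K L] ∀ w : v.Extension B, w.1.adicCompletion L :=
  Pi.semialgHom _ _ fun i ↦ i.adicCompletionSemialgHom K L

/-- The canonical ring homomorphism `L ⊗_K K_v → ∏_{w|v} L_w` as an `L`-algebra map.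
(In Mathlib's namespace `IsDedekindDomain.HeightOneSpectrum.adicCompletion`: a deliberate extension
under FLT's name, for dot notation and so that the later packet files apply unchanged — CONVENTIONS §2.)
[cite: FLTProject2025, FLT/DedekindDomain/Completion/BaseChange.lean · IsDedekindDomain.HeightOneSpectrum.adicCompletion.baseChange] -/
noncomputable abbrev baseChange :
    L ⊗[K] adicCompletion K v →ₐ[L] Π w : v.Extension B, w.1.adicCompletion L :=
  (semialgHomPi K L B v).baseChangeOfAlgebraMap

/-- `adicCompletion.baseChange K L B v (x ⊗ₜ y) w = algebraMap L L_w x * algebraMap K_v L_w y`.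
(In Mathlib's namespace `IsDedekindDomain.HeightOneSpectrum.adicCompletion`: a deliberate extension
under FLT's name, for dot notation and so that the later packet files apply unchanged — CONVENTIONS §2.)
[cite: FLTProject2025, FLT/DedekindDomain/Completion/BaseChange.lean · IsDedekindDomain.HeightOneSpectrum.adicCompletion.baseChange_tmul_apply] -/
lemma baseChange_tmul_apply (x y w) : baseChange K L B v (x ⊗ₜ y) w =
    (algebraMap _ (w.1.adicCompletion L) x) * (algebraMap _ (w.1.adicCompletion L) y) := rfl

open scoped TensorProduct.RightActions in
/-- The canonical ring homomorphism `L ⊗_K K_v → ∏_{w|v} L_w` as an `K_v`-linear map.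
(In Mathlib's namespace `IsDedekindDomain.HeightOneSpectrum.adicCompletion`: a deliberate extension
under FLT's name, for dot notation and so that the later packet files apply unchanged — CONVENTIONS §2.)
[cite: FLTProject2025, FLT/DedekindDomain/Completion/BaseChange.lean · IsDedekindDomain.HeightOneSpectrum.adicCompletion.baseChangeRight] -/
noncomputable abbrev baseChangeRight :
    L ⊗[K] adicCompletion K v →ₐ[adicCompletion K v] Π w : v.Extension B, w.1.adicCompletion L :=
  (semialgHomPi K L B v).baseChangeRightOfAlgebraMap

section ModuleTopology

open WithZeroMulInt Valued in
-- Make (v.adicCompletion K) a normed field.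
-- This exists for number fields in Mathlib, but not for general Dedekind Domains.
-- v.asIdeal.absNorm may be 0, so just use 2 as the base for the norm.
/-- The data of a rank 1 (ℝ-valued) valuation on K_v. (In Mathlib's namespace `IsDedekindDomain.HeightOneSpectrum.adicCompletion`: a deliberate extension under FLT's name, for dot notation and so that the later packet files apply unchanged — CONVENTIONS §2.) -/
noncomputable local instance :
    Valuation.RankOne (Valued.v : Valuation (adicCompletion K v) ℤᵐ⁰) where
  hom' := (toNNReal (by norm_num : (2 : NNReal) ≠ 0)).comp
    (valueGroup₀_equiv_withZeroMulInt _).toMonoidWithZeroHom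
  strictMono' := toNNReal_strictMono (by norm_num) |>.comp
    (by simpa using! valueGroup₀_equiv_withZeroMulInt_strictMono _)
  exists_val_nontrivial := by
    obtain ⟨x, hx1, hx2⟩ := Submodule.exists_mem_ne_zero_of_ne_bot v.ne_bot
    use algebraMap A K x
    rw [valuedAdicCompletion_eq_valuation' v (algebraMap A K x)]
    constructor
    · simpa only [ne_eq, map_eq_zero, FaithfulSMul.algebraMap_eq_zero_iff]
    · apply ne_of_lt
      rwa [valuation_of_algebraMap, intValuation_lt_one_iff_mem]

set_option backward.isDefEq.respectTransparency false in
open scoped TensorProduct.RightActions in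
/-- The canonical map `L ⊗[K] K_v → ∏_{w|v} L_w` is surjective.
(In Mathlib's namespace `IsDedekindDomain.HeightOneSpectrum.adicCompletion`: a deliberate extension
under FLT's name, for dot notation and so that the later packet files apply unchanged — CONVENTIONS §2.)
[cite: FLTProject2025, FLT/DedekindDomain/Completion/BaseChange.lean · IsDedekindDomain.HeightOneSpectrum.adicCompletion.baseChangeRight_surjective] -/
lemma baseChangeRight_surjective [FiniteDimensional K L] :
    Function.Surjective (baseChangeRight K L B v) := by
  let s := (baseChangeRight K L B v).toLinearMap.range
  have isClosed : IsClosed s.carrier :=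
    Submodule.closed_of_finiteDimensional (E := (w : Extension B v) → adicCompletion L w.val) s
  rw [← AlgHom.coe_toLinearMap, ← LinearMap.range_eq_top, Submodule.eq_top_iff']
  simp_rw [← Submodule.mem_toAddSubmonoid, ← AddSubmonoid.mem_toSubsemigroup,
      ← AddSubsemigroup.mem_carrier]
  have denseL : DenseRange (algebraMap L ((w : Extension B v) → adicCompletion L w.val)) := by
    have := Extension.finite A K L B v
    exact denseRange_of_prodAlgebraMap _ Subtype.val_injective
  rw [← isClosed.closure_eq]
  apply Dense.mono _ denseL
  rintro _ ⟨l, rfl⟩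
  use (l ⊗ₜ 1)
  simp

open scoped TensorProduct.RightActions in
/-- ∏_{w|v} L_w is a finite K_v-module. (In Mathlib's namespace `IsDedekindDomain.HeightOneSpectrum.adicCompletion`: a deliberate extension under FLT's name, for dot notation and so that the later packet files apply unchanged — CONVENTIONS §2.) -/
instance [FiniteDimensional K L] :
    Module.Finite (adicCompletion K v) (Π w : v.Extension B, w.1.adicCompletion L) :=
  .of_surjective (baseChangeRight K L B v).toLinearMap (baseChangeRight_surjective K L B v)

/-- L_w is a finite K_v-module if w | v. (In Mathlib's namespace `IsDedekindDomain.HeightOneSpectrum.adicCompletion`: a deliberate extension under FLT's name, for dot notation and so that the later packet files apply unchanged — CONVENTIONS §2.) -/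
instance [FiniteDimensional K L] (w : v.Extension B) :
    Module.Finite (adicCompletion K v) (adicCompletion L w.1) :=
  Module.Finite.of_pi (fun (w : Extension B v) => w.1.adicCompletion L) w

/-- L_w has the K_v-module topology.
(In Mathlib's namespace `IsDedekindDomain.HeightOneSpectrum.adicCompletion`: a deliberate extension
under FLT's name, for dot notation and so that the later packet files apply unchanged — CONVENTIONS §2.)
[cite: FLTProject2025, FLT/DedekindDomain/Completion/BaseChange.lean · IsDedekindDomain.HeightOneSpectrum.adicCompletion.instIsModuleTopology] -/
instance instIsModuleTopology [FiniteDimensional K L] (w : v.Extension B) :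
    IsModuleTopology (v.adicCompletion K) (w.1.adicCompletion L) := by
  let Kv := adicCompletion K v
  let Lw := adicCompletion L w.1
  let iso : ((Fin (Module.finrank Kv Lw)) → Kv) ≃L[Kv] Lw :=
    ContinuousLinearEquiv.ofFinrankEq (Module.finrank_fin_fun Kv)
  apply IsModuleTopology.iso iso

/-- ∏_{w|v} L_w has the K_v-module topology.
(In Mathlib's namespace `IsDedekindDomain.HeightOneSpectrum.adicCompletion`: a deliberate extension
under FLT's name, for dot notation and so that the later packet files apply unchanged — CONVENTIONS §2.)
[cite: FLTProject2025, FLT/DedekindDomain/Completion/BaseChange.lean · IsDedekindDomain.HeightOneSpectrum.adicCompletion.instIsModuleTopologyPi] -/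
instance instIsModuleTopologyPi [FiniteDimensional K L] :
    -- the claim that L_w has the module topology.
    IsModuleTopology (v.adicCompletion K) (Π (w : v.Extension B), w.1.adicCompletion L) := by
  let := Extension.finite A K L B v
  exact IsModuleTopology.instPi

open scoped TensorProduct.RightActions in
/-- `tensorAdicCompletionComapLinearMap` is continuous, open and surjective.
  We later show that it's a homeomorphism.
(In Mathlib's namespace `IsDedekindDomain.HeightOneSpectrum.adicCompletion`: a deliberate extension
under FLT's name, for dot notation and so that the later packet files apply unchanged — CONVENTIONS §2.)
[cite: FLTProject2025, FLT/DedekindDomain/Completion/BaseChange.lean · IsDedekindDomain.HeightOneSpectrum.adicCompletion.baseChangeRight_isOpenQuotientMap] -/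
lemma baseChangeRight_isOpenQuotientMap [FiniteDimensional K L] :
    IsOpenQuotientMap (baseChangeRight K L B v) := by
  have : T2Space (L ⊗[K] adicCompletion K v) :=
    IsModuleTopology.t2Space' (K := (adicCompletion K v))
  have hsurj := baseChangeRight_surjective K L B v
  rw [← AlgHom.coe_toLinearMap]
  exact ⟨hsurj, LinearMap.continuous_of_finiteDimensional _,
    LinearMap.isOpenMap_of_finiteDimensional _ hsurj⟩

end ModuleTopology

end adicCompletion

section ModuleTopology

open Extension adicCompletion

variable (B)

/-- The canonical B-algebra map `B ⊗[A] 𝓞_v → L ⊗[K] K_v`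
(In Mathlib's namespace `IsDedekindDomain.HeightOneSpectrum`: a deliberate extension under FLT's
name, for dot notation and so that the later packet files apply unchanged — CONVENTIONS §2.)
[cite: FLTProject2025, FLT/DedekindDomain/Completion/BaseChange.lean · IsDedekindDomain.HeightOneSpectrum.tensorAdicCompletionIntegersTo] -/
noncomputable def tensorAdicCompletionIntegersTo :
    B ⊗[A] adicCompletionIntegers K v →ₐ[B] L ⊗[K] adicCompletion K v :=
  Algebra.TensorProduct.lift
    (Algebra.algHom _ _ _)
    ((Algebra.TensorProduct.includeRight.restrictScalars A).comp (IsScalarTower.toAlgHom _ _ _))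
    (fun _ _ ↦ .all _ _)

omit [Algebra.IsIntegral A B] [IsDedekindDomain B] [IsFractionRing B L] in
/-- `tensorAdicCompletionIntegersTo K L B v (b ⊗ₜ x) = algebraMap B L b ⊗ₜ ↑x`.
(In Mathlib's namespace `IsDedekindDomain.HeightOneSpectrum`: a deliberate extension under FLT's
name, for dot notation and so that the later packet files apply unchanged — CONVENTIONS §2.)
[cite: FLTProject2025, FLT/DedekindDomain/Completion/BaseChange.lean · IsDedekindDomain.HeightOneSpectrum.tensorAdicCompletionIntegersTo_tmul] -/
@[simp]
lemma tensorAdicCompletionIntegersTo_tmul (v : HeightOneSpectrum A) (b : B)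
    (x : v.adicCompletionIntegers K) : tensorAdicCompletionIntegersTo K L B v (b ⊗ₜ x) =
      (algebraMap B L b) ⊗ₜ x.val := by
  simp [tensorAdicCompletionIntegersTo, Algebra.algHom]

omit [Algebra.IsIntegral A B] [IsDedekindDomain B] [IsFractionRing B L] in
open scoped TensorProduct.RightActions in
/-- The image of `B ⊗[A] 𝓞_v` in `L ⊗[K] K_v` is contained in the closure of the image of `B`.
(In Mathlib's namespace `IsDedekindDomain.HeightOneSpectrum`: a deliberate extension under FLT's
name, for dot notation and so that the later packet files apply unchanged — CONVENTIONS §2.)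
[cite: FLTProject2025, FLT/DedekindDomain/Completion/BaseChange.lean · IsDedekindDomain.HeightOneSpectrum.tensorAdicCompletionIntegersTo_range_subset_closure] -/
lemma tensorAdicCompletionIntegersTo_range_subset_closure [FiniteDimensional K L] :
  (tensorAdicCompletionIntegersTo K L B v).range.carrier ⊆
    closure (algebraMap B (L ⊗[K] adicCompletion K v)).range := by
  rintro _ ⟨s, rfl⟩
  induction s with
    | zero =>
        apply subset_closure
        use 0
        simp
    | add x y hx hy =>
        -- The closure of a subgroup is a subgroup
        rw [RingHom.map_add]
        apply map_mem_closure₂ _ hx hy _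
        · exact (ModuleTopology.continuousAdd _ _).continuous_add
        intro _ ha _ hb
        exact add_mem ha hb
    | tmul b a' =>
        -- Rewrite `tensorAdicCompletionTo (b ⊗ₜ a')` to `b • (1 ⊗ₜ a')`
        simp only [RingHom.coe_range, tensorAdicCompletionIntegersTo,
          AlgHom.toRingHom_eq_coe, RingHom.coe_coe, Algebra.TensorProduct.lift_tmul,
          AlgHom.coe_comp, AlgHom.coe_restrictScalars', IsScalarTower.coe_toAlgHom',
          Function.comp_apply, ValuationSubring.algebraMap_apply,
          Algebra.TensorProduct.includeRight_apply]
        -- Now, `f : a' ↦ b • (1 ⊗ₜ a')` is continuous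
        let f (y : ↥(adicCompletionIntegers K v)) : (L ⊗[K] adicCompletion K v) :=
          (Algebra.ofId B (L ⊗[K] adicCompletion K v)) b * (1 : L) ⊗ₜ[K] (y : adicCompletion K v)
        have hfval : f = fun (y : ↥(adicCompletionIntegers K v)) =>
              (y : adicCompletion K v) • (Algebra.ofId B (L ⊗[K] adicCompletion K v)) b := by
          ext y
          unfold f
          rw [Algebra.smul_def]
          exact mul_comm _ _
        have hcf : ContinuousAt f a' := by
          rw [hfval]
          fun_prop
        -- So, because `A` is dense in `𝒪_v`, `b • (1 ⊗ₜ a') ∈ f '' closure A ⊆ closure f '' A`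
        have hy : a' ∈ closure (Set.range (algebraMap A _)) := by
          apply denseRange_of_integerAlgebraMap
        apply mem_closure_image hcf hy
        constructor
        · exact isClosed_closure
        -- Finally, `b • (1 ⊗ₜ a) = (b * a) • (1 ⊗ₜ 1)`, so `f '' A ⊆ algebraMap '' B`
        rintro u ⟨_, ⟨a, rfl⟩, rfl⟩
        apply subset_closure
        use algebraMap A B a * b
        unfold f
        rw [Algebra.algebraMap_eq_smul_one (A := (adicCompletionIntegers K v)) a,
          coe_smul_adicCompletionIntegers, ← TensorProduct.smul_tmul, Algebra.ofId_apply,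
          Algebra.TensorProduct.algebraMap_apply, RingHom.map_mul, ← Algebra.smul_def]
        simp

open scoped TensorProduct.RightActions in
omit [Algebra.IsIntegral A B] [IsDedekindDomain B] [IsFractionRing B L]  in
/-- The image of `B ⊗[A] 𝓞_v` in `L ⊗[K] K_v` is clopen.
(In Mathlib's namespace `IsDedekindDomain.HeightOneSpectrum`: a deliberate extension under FLT's
name, for dot notation and so that the later packet files apply unchanged — CONVENTIONS §2.)
[cite: FLTProject2025, FLT/DedekindDomain/Completion/BaseChange.lean · IsDedekindDomain.HeightOneSpectrum.tensorAdicCompletionIntegersTo_isClopen_range] -/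
lemma tensorAdicCompletionIntegersTo_isClopen_range
    [IsIntegralClosure B A L] [FiniteDimensional K L] :
    IsClopen (SetLike.coe (tensorAdicCompletionIntegersTo K L B v).range) := by
  -- `B ⊗[A] 𝒪_v` is a subgroup of `L ⊗[K] K_v`, so we can show it's closed
  -- by showing that it's open. **TODO** split into IsOpen + IsClosed lemmas?
  have : SeparatelyContinuousAdd (L ⊗[K] v.adicCompletion K) :=
    instSeparatelyContinuousAddOfContinuousAdd
  rw [← Subalgebra.coe_toSubring, ← Subring.coe_toAddSubgroup]
  refine OpenAddSubgroup.isClopen ⟨_, ?_⟩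
  -- Further, we can show `B ⊗[A] 𝒪_v` is open by showing that it contains an
  -- open neighbourhood of 0.
  apply AddSubgroup.isOpen_of_zero_mem_interior
  rw [mem_interior, Subring.coe_toAddSubgroup, Subalgebra.coe_toSubring]
  -- Take a basis `b` of `L` over `K` with elements in `B` and use it to
  -- get a basis `b'` of `L ⊗[K] K_v` over `K_v`.
  obtain ⟨ι, b, hb⟩ := FiniteDimensional.exists_is_basis_integral A K L
  let b' : Module.Basis ι (adicCompletion K v) (L ⊗[K] (adicCompletion K v)) := by
    classical
    exact b.rightBaseChange L
  -- Use the basis to get a continuous equivalence from `L ⊗[K] K_v` to `ι → K_v`.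
  let equiv : L ⊗[K] (adicCompletion K v) ≃L[v.adicCompletion K] (ι → adicCompletion K v) :=
    IsModuleTopology.continuousLinearEquiv (b'.equivFun)
  -- Use the preimage of `∏ 𝒪_v` as the open neighbourhood.
  use equiv.symm '' (Set.pi Set.univ (fun _ => SetLike.coe (adicCompletionIntegers K v)))
  refine ⟨?_, ?_, by simp⟩
  · intro t ⟨g, hg, ht⟩
    -- We have `t = equiv g = ∑ i, b i ⊗ g i`, since `g in ∏ 𝒪_v` and
    -- `b i ∈ (algebraMap B L).range`, this is `tensorAdicCompletionTo`
    -- of some element of `B ⊗[A] 𝒪_v`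
    have hf : ∀ (i : ι), ∃ (w : B), (algebraMap B L w) = (b i) := by
      intro i
      apply IsIntegralClosure.isIntegral_iff.mp (hb i)
    choose f hf_prop using hf
    let b : B ⊗[A] ↥(adicCompletionIntegers K v) := ∑ (i : ι), (f i) ⊗ₜ ⟨g i, hg i trivial⟩
    use b
    rw [AlgHom.toRingHom_eq_coe, RingHom.coe_coe, map_sum, ← ht]
    unfold equiv
    rw [IsModuleTopology.continuousLinearEquiv_symm_apply, Module.Basis.equivFun_symm_apply]
    apply Finset.sum_congr rfl
    intro x
    simp only [Finset.univ_eq_attach, Finset.mem_attach, tensorAdicCompletionIntegersTo_tmul,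
      hf_prop, Module.Basis.rightBaseChange_apply, Algebra.smul_def,
      TensorProduct.RightActions.algebraMap_eval, Algebra.TensorProduct.tmul_mul_tmul, one_mul,
      mul_one, imp_self, b']
  · rw [ContinuousLinearEquiv.image_symm_eq_preimage]
    apply IsOpen.preimage equiv.continuous
    apply isOpen_set_pi Set.finite_univ
    rintro i -
    exact Valued.isOpen_valuationSubring (v.adicCompletion K)

omit [Algebra.IsIntegral A B] [IsDedekindDomain B] [IsFractionRing B L] in
open scoped TensorProduct.RightActions in
/-- The image of `B ⊗[A] 𝓞_v` in `L ⊗[K] K_v` is the closure of the image of `B`.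
(In Mathlib's namespace `IsDedekindDomain.HeightOneSpectrum`: a deliberate extension under FLT's
name, for dot notation and so that the later packet files apply unchanged — CONVENTIONS §2.)
[cite: FLTProject2025, FLT/DedekindDomain/Completion/BaseChange.lean · IsDedekindDomain.HeightOneSpectrum.range_tensorAdicCompletionIntegersTo_eq_closure_range_algebraMap] -/
lemma range_tensorAdicCompletionIntegersTo_eq_closure_range_algebraMap
    [IsIntegralClosure B A L] [FiniteDimensional K L] :
    Set.range (tensorAdicCompletionIntegersTo K L B v) =
      closure (Set.range (algebraMap B (L ⊗[K] adicCompletion K v))) := by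
  apply Set.Subset.antisymm
  · apply tensorAdicCompletionIntegersTo_range_subset_closure
  · apply closure_minimal
    · rintro _ ⟨b, rfl⟩
      use b ⊗ₜ[A] 1
      simp
    · apply IsClopen.isClosed
      apply tensorAdicCompletionIntegersTo_isClopen_range

omit [Algebra A L] [IsScalarTower A B L] in
/-- The `B`-subalgebra `∏_{w|v} 𝓞_w` of `∏_{w|v} L_w` is the closure of the image of `B`.
(In Mathlib's namespace `IsDedekindDomain.HeightOneSpectrum`: a deliberate extension under FLT's
name, for dot notation and so that the later packet files apply unchanged — CONVENTIONS §2.)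
[cite: FLTProject2025, FLT/DedekindDomain/Completion/BaseChange.lean · IsDedekindDomain.HeightOneSpectrum.pi_adicCompletionIntegers_eq_closure_range_algebraMap] -/
lemma pi_adicCompletionIntegers_eq_closure_range_algebraMap :
    (Set.univ.pi (fun (w : Extension B v) ↦ (w.1.adicCompletionIntegers L).carrier)) =
      closure (Set.range (algebraMap B _)) := by
  let val := fun (w : Extension B v) ↦ w.1
  have hinj : Function.Injective val :=
    (Set.injective_codRestrict Subtype.property).mp fun _ _ a ↦ a
  rw [← closureAlgebraMapIntegers_eq_prodIntegers L _ hinj]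
  rfl

open scoped TensorProduct.RightActions in
/-- The image of `B ⊗[A] 𝓞_v` (the closure of `B`) in `∏_w L_w` is closed.
(In Mathlib's namespace `IsDedekindDomain.HeightOneSpectrum`: a deliberate extension under FLT's
name, for dot notation and so that the later packet files apply unchanged — CONVENTIONS §2.)
[cite: FLTProject2025, FLT/DedekindDomain/Completion/BaseChange.lean · IsDedekindDomain.HeightOneSpectrum.isClosed_baseChange_image_closure_range_algebraMap] -/
lemma isClosed_baseChange_image_closure_range_algebraMap [FiniteDimensional K L] :
    IsClosed ((baseChange K L B v) ''
        closure (Set.range (algebraMap B (L ⊗[K] adicCompletion K v)))) := by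
  let S := AddSubgroup.map
      (baseChange K L B v).toAddMonoidHom
      (tensorAdicCompletionIntegersTo K L B v).range.toSubring.toAddSubgroup
  have hSclosed : IsClosed S.carrier := by
    apply AddSubgroup.isClosed_of_isOpen
    apply (baseChangeRight_isOpenQuotientMap K L B v).isOpenMap
    apply (tensorAdicCompletionIntegersTo_isClopen_range K L B v).isOpen
  suffices h : (baseChange K L B v) ''
    closure (Set.range (algebraMap B (L ⊗[K] adicCompletion K v))) = S.carrier by
    rwa [h]
  rw [← range_tensorAdicCompletionIntegersTo_eq_closure_range_algebraMap]
  rfl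

/-- `L`-algebra maps `L ⊗[K] K_v →ₐ[L] ∏_{w∣v} L_w` commute with the `B`-action. (In Mathlib's namespace `IsDedekindDomain.HeightOneSpectrum`: a deliberate extension under FLT's name, for dot notation and so that the later packet files apply unchanged — CONVENTIONS §2.) -/
instance : MulActionHomClass
    (L ⊗[K] adicCompletion K v →ₐ[L] (w : Extension B v) → adicCompletion L w.1) B
    (L ⊗[K] adicCompletion K v) ((w : Extension B v) → adicCompletion L w.1) where
  map_smulₛₗ φ b x := by
    rw [← IsScalarTower.algebraMap_smul L, AlgHom.map_smul_of_tower,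
      IsScalarTower.algebraMap_smul, id_def]

open scoped TensorProduct.RightActions in
/-- The image of `B ⊗[A] 𝓞_v` in `∏_w L_w` is `∏_w 𝓞_w`.
(In Mathlib's namespace `IsDedekindDomain.HeightOneSpectrum`: a deliberate extension under FLT's
name, for dot notation and so that the later packet files apply unchanged — CONVENTIONS §2.)
[cite: FLTProject2025, FLT/DedekindDomain/Completion/BaseChange.lean · IsDedekindDomain.HeightOneSpectrum.range_baseChange_comp_tensorAdicCompletionTo_eq_pi] -/
theorem range_baseChange_comp_tensorAdicCompletionTo_eq_pi [FiniteDimensional K L] :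
    Set.range (baseChange K L B v ∘ tensorAdicCompletionIntegersTo K L B v) =
    Set.univ.pi (fun w ↦ (w.1.adicCompletionIntegers L).carrier) := by
  have hrange :
    Set.range (algebraMap B ((w : Extension B v) → adicCompletion L w.1)) =
      (baseChange K L B v) '' (Set.range (algebraMap B (L ⊗[K] adicCompletion K v))) := by
    ext x
    simp [Algebra.algebraMap_eq_smul_one]
  have hrange' := isClosed_baseChange_image_closure_range_algebraMap K L B v
  rw [Set.range_comp, range_tensorAdicCompletionIntegersTo_eq_closure_range_algebraMap,
    pi_adicCompletionIntegers_eq_closure_range_algebraMap, hrange, ← IsClosed.closure_eq hrange']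
  exact closure_image_closure
    (baseChangeRight_isOpenQuotientMap K L B v).continuous

namespace Extension

variable {B} (w : v.Extension B)

/-- The restriction of `adicCompletionSemialgHom` to a map `𝓞_v → 𝓞_w`.
(In Mathlib's namespace `IsDedekindDomain.HeightOneSpectrum.Extension`: a deliberate extension
under FLT's name, for dot notation and so that the later packet files apply unchanged — CONVENTIONS §2.)
[cite: FLTProject2025, FLT/DedekindDomain/Completion/BaseChange.lean · IsDedekindDomain.HeightOneSpectrum.Extension.adicCompletionIntegersRingHom] -/
noncomputable def adicCompletionIntegersRingHom :
    v.adicCompletionIntegers K →+* w.1.adicCompletionIntegers L :=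
  RingHom.restrict (w.adicCompletionSemialgHom K L) _ _
    fun x hx ↦ w.adicCompletionSemialgHom_image_adicCompletionIntegers K L ⟨x, hx, rfl⟩

/-- If `w` is an extension of `v`, then `𝓞_w` is naturally an `𝓞_v`-algebra. (In Mathlib's namespace `IsDedekindDomain.HeightOneSpectrum.Extension`: a deliberate extension under FLT's name, for dot notation and so that the later packet files apply unchanged — CONVENTIONS §2.) -/
noncomputable instance : Algebra (v.adicCompletionIntegers K) (w.1.adicCompletionIntegers L) :=
  (w.adicCompletionIntegersRingHom K L).toAlgebra

/-- The structure map `𝒪_v → 𝒪_w` (`w ∣ v`) is the restriction of `adicCompletionSemialgHom`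
(`rfl`).
(In Mathlib's namespace `IsDedekindDomain.HeightOneSpectrum.Extension`: a deliberate extension
under FLT's name, for dot notation and so that the later packet files apply unchanged — CONVENTIONS §2.)
[cite: FLTProject2025, FLT/DedekindDomain/Completion/BaseChange.lean · IsDedekindDomain.HeightOneSpectrum.Extension.integer_algebraMap_apply] -/
lemma integer_algebraMap_apply (x : v.adicCompletionIntegers K) :
    algebraMap (v.adicCompletionIntegers K) (w.1.adicCompletionIntegers L) x =
      (w.adicCompletionSemialgHom K L) x.val := rfl

variable {v} in
/-- If `w` is an extension of `v`, then `L_w` is naturally an `𝓞_v`-algebra. (In Mathlib's namespace `IsDedekindDomain.HeightOneSpectrum.Extension`: a deliberate extension under FLT's name, for dot notation and so that the later packet files apply unchanged — CONVENTIONS §2.) -/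
noncomputable instance : Algebra (v.adicCompletionIntegers K) (w.1.adicCompletion L) :=
  Algebra.compHom (w.1.adicCompletion L) (algebraMap _ (adicCompletion K v))

end Extension

open scoped TensorProduct.RightActions in
/-- `tensorAdicCompletionIntegersTo K L B v : B ⊗[A] 𝒪_v → L ⊗[K] K_v` is `B`-linear and
`𝒪_v`-linear (`IsBiscalar`). (In Mathlib's namespace `IsDedekindDomain.HeightOneSpectrum`: a deliberate extension under FLT's name, for dot notation and so that the later packet files apply unchanged — CONVENTIONS §2.) -/
instance : IsBiscalar B (v.adicCompletionIntegers K) (tensorAdicCompletionIntegersTo K L B v) where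
  map_smul₁ _ _ := map_smul ..
  map_smul₂ _ _ := by
    simp only [tensorAdicCompletionIntegersTo_tmul, Algebra.smul_def,
      TensorProduct.RightActions.algebraMap_eval, map_mul, map_one]
    rfl

/-- `𝒪_v ⊆ K_v → L_w` is a scalar tower (`w ∣ v`). (In Mathlib's namespace `IsDedekindDomain.HeightOneSpectrum`: a deliberate extension under FLT's name, for dot notation and so that the later packet files apply unchanged — CONVENTIONS §2.) -/
instance {w : v.Extension B} : IsScalarTower (adicCompletionIntegers K v) (adicCompletion K v)
    (w.1.adicCompletion L) := Submonoid.instIsScalarTowerSubtypeMem (adicCompletionIntegers K v)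

open scoped TensorProduct.RightActions in
/-- The `O_v`-linear map from `B ⊗[A] 𝓞ᵥ` to `Π v ∣ w, L_w`
(In Mathlib's namespace `IsDedekindDomain.HeightOneSpectrum`: a deliberate extension under FLT's
name, for dot notation and so that the later packet files apply unchanged — CONVENTIONS §2.)
[cite: FLTProject2025, FLT/DedekindDomain/Completion/BaseChange.lean · IsDedekindDomain.HeightOneSpectrum.tensorAdicCompletionIntegersToPiRight] -/
noncomputable def tensorAdicCompletionIntegersToPiRight :
    B ⊗[A] v.adicCompletionIntegers K →ₐ[v.adicCompletionIntegers K]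
        Π w : v.Extension B, w.1.adicCompletion L :=
  ((baseChangeRight K L B v).restrictScalars _).comp
    ((tensorAdicCompletionIntegersTo K L B v).changeScalars _)

namespace Extension

variable (w : v.Extension B)

open scoped TensorProduct.RightActions in
/-- The map `B ⊗ 𝓞_v → L_w` for `w` an extension of `v` given by the algebra maps.
(In Mathlib's namespace `IsDedekindDomain.HeightOneSpectrum.Extension`: a deliberate extension
under FLT's name, for dot notation and so that the later packet files apply unchanged — CONVENTIONS §2.)
[cite: FLTProject2025, FLT/DedekindDomain/Completion/BaseChange.lean · IsDedekindDomain.HeightOneSpectrum.Extension.tensorAdicCompletionIntegersToAdicCompletion] -/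
noncomputable def tensorAdicCompletionIntegersToAdicCompletion :
    B ⊗[A] (adicCompletionIntegers K v) →ₐ[adicCompletionIntegers K v] adicCompletion L w.1 :=
  Pi.evalAlgHom _ _ w |>.comp (tensorAdicCompletionIntegersToPiRight K L B v)

open scoped TensorProduct.RightActions in
/-- The range of `adicCompletionIntegers.tensorToAdicCompletion` is `𝓞_w`.
(In Mathlib's namespace `IsDedekindDomain.HeightOneSpectrum.Extension`: a deliberate extension
under FLT's name, for dot notation and so that the later packet files apply unchanged — CONVENTIONS §2.)
[cite: FLTProject2025, FLT/DedekindDomain/Completion/BaseChange.lean · IsDedekindDomain.HeightOneSpectrum.Extension.tensorAdicCompletionIntegersToAdicCompletion_range_eq_integers] -/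
lemma tensorAdicCompletionIntegersToAdicCompletion_range_eq_integers [FiniteDimensional K L] :
    Set.range (w.tensorAdicCompletionIntegersToAdicCompletion K L B v) =
      adicCompletionIntegers L w.1 := by
  ext x
  have memrange := (range_baseChange_comp_tensorAdicCompletionTo_eq_pi K L B v)
  rw [Set.ext_iff] at memrange
  constructor
  · rintro ⟨y, rfl⟩
    exact (memrange _).mp (Set.mem_range_self y) w trivial
  · intro hx
    classical
    set x' : (w : Extension B v) → adicCompletion L w.val := Pi.single w x with hx'
    obtain ⟨y, (hy : _ = x')⟩ : x' ∈ Set.range _ := by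
      rw [memrange x', Set.mem_pi]
      intro w' _
      by_cases h : w = w'
      · rw [← h, hx', Pi.single_eq_same]
        exact hx
      · rw [hx', Pi.single_eq_of_ne' h]
        exact Subring.zero_mem _
    use y
    simpa [hx'] using! congr_fun hy w

/-- A shortcut instance for the action of `𝓞ᵥ` on `Kᵥ`. (In Mathlib's namespace `IsDedekindDomain.HeightOneSpectrum.Extension`: a deliberate extension under FLT's name, for dot notation and so that the later packet files apply unchanged — CONVENTIONS §2.) -/
noncomputable local instance : MulAction (v.adicCompletionIntegers K) (v.adicCompletion K) :=
  LieAlgebra.ofAssociativeAlgebra.toMulAction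

open scoped TensorProduct.RightActions in
/-- `𝓞_w` is finite over `𝓞_v`. (In Mathlib's namespace `IsDedekindDomain.HeightOneSpectrum.Extension`: a deliberate extension under FLT's name, for dot notation and so that the later packet files apply unchanged — CONVENTIONS §2.) -/
-- This can be proved for finite extensions of complete discretely valued fields without
-- reference to underlying fields being completed, but this is sufficient for our
-- purposes.
noncomputable instance (priority := 1001) [Module.Finite A B] [FiniteDimensional K L] :
    Module.Finite (adicCompletionIntegers K v) (adicCompletionIntegers L w.1) := by
  let integerSubmodule : Submodule (adicCompletionIntegers K v) (adicCompletion L w.1) :=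
    let : Algebra (v.adicCompletionIntegers K) (w.1.adicCompletionIntegers L).toSubring :=
      inferInstanceAs (Algebra (adicCompletionIntegers K v) (adicCompletionIntegers L w.1))
    have : IsScalarTower (adicCompletionIntegers K v) (adicCompletionIntegers L w.1)
        (adicCompletion L w.1) := .of_algebraMap_smul fun _ _ ↦ rfl
    (adicCompletionIntegers L w.1).toSubmodule.restrictScalars
      (adicCompletionIntegers K v)
  have heq : (w.tensorAdicCompletionIntegersToAdicCompletion K L B v).toLinearMap.range =
      integerSubmodule := by
    ext x
    apply w.tensorAdicCompletionIntegersToAdicCompletion_range_eq_integers K L B v |> Set.ext_iff.mp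
  have := Module.Finite.range (w.tensorAdicCompletionIntegersToAdicCompletion K L B v).toLinearMap
  have := w.tensorAdicCompletionIntegersToAdicCompletion_range_eq_integers K L B v
  exact Module.Finite.equiv <| LinearEquiv.ofEq
    (LinearMap.range (w.tensorAdicCompletionIntegersToAdicCompletion K L B v).toLinearMap) _ heq

end Extension

end ModuleTopology

namespace adicCompletion

open Extension

section RamificationInertia

variable {v} (w : v.Extension B)

/-- In `ℤᵐ⁰`, `ofAdd (-n) = (ofAdd (-1)) ^ n`.
(In Mathlib's namespace `WithZero`: a deliberate extension under FLT's name, for dot notation and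
so that the later packet files apply unchanged — CONVENTIONS §2.)
[cite: FLTProject2025, FLT/DedekindDomain/Completion/BaseChange.lean · WithZero.ofAdd_neg_ofNat_pow] -/
lemma _root_.WithZero.ofAdd_neg_ofNat_pow (n : ℕ) :
    (WithZero.coe (Multiplicative.ofAdd (-n : ℤ))) = (Multiplicative.ofAdd (-1 : ℤ)) ^ n := by
  rw [← WithZero.coe_pow, ← ofAdd_nsmul, nsmul_eq_mul, Int.mul_neg_one]

/-- The maximal ideal of `𝒪_w` lies over the maximal ideal of `𝒪_v`.
(In Mathlib's namespace `IsDedekindDomain.HeightOneSpectrum.adicCompletion`: a deliberate extension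
under FLT's name, for dot notation and so that the later packet files apply unchanged — CONVENTIONS §2.)
[cite: FLTProject2025, FLT/DedekindDomain/Completion/BaseChange.lean · IsDedekindDomain.HeightOneSpectrum.adicCompletion.liesOver_completionIdeal] -/
lemma liesOver_completionIdeal :
    (w.1.completionIdeal L).LiesOver (v.completionIdeal K) where
  over := by
    rw [Ideal.under_def]
    ext x
    rw [Ideal.mem_comap, mem_completionIdeal_iff, mem_completionIdeal_iff,
      integer_algebraMap_apply, valued_adicCompletionSemialgHom K L, pow_lt_one_iff]
    exact ramificationIdx_ne_zero A B (algebraMap_injective_of_field_isFractionRing A B K L) w.1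

/-- The local ramification index of `L_w/K_v` equals the global ramification index of `w/v`.
(In Mathlib's namespace `IsDedekindDomain.HeightOneSpectrum.adicCompletion`: a deliberate extension
under FLT's name, for dot notation and so that the later packet files apply unchanged — CONVENTIONS §2.)
[cite: FLTProject2025, FLT/DedekindDomain/Completion/BaseChange.lean · IsDedekindDomain.HeightOneSpectrum.adicCompletion.ramificationIdx_eq_ramificationIdx] -/
theorem ramificationIdx_eq_ramificationIdx :
    (w.1.completionIdeal L).ramificationIdx (v.adicCompletionIntegers K) =
      w.1.asIdeal.ramificationIdx A := by
  have := liesOver_completionIdeal K L w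
  have : IsScalarTower (adicCompletionIntegers K v) (adicCompletionIntegers L w.1)
      (adicCompletion L w.1) := .of_algebraMap_smul fun _ _ ↦ rfl
  have : IsScalarTower (adicCompletionIntegers K v) (adicCompletion K v) (adicCompletion L w.1) :=
    .of_algebraMap_smul fun _ _ ↦ rfl
  have : FaithfulSMul (adicCompletionIntegers K v) (adicCompletionIntegers L w.1) :=
    FaithfulSMul.of_field_isFractionRing _ _ (adicCompletion K v) (adicCompletion L w.1)
  -- `Ideal.ramificationIdx'` is the one characterised by `map p ≤ P ^ n` and `¬ map p ≤ P ^ (n+1)`,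
  -- so we check that characterisation for the global ramification index of `w/v`.
  rw [← Ideal.ramificationIdx'_eq_ramificationIdx (v.completionIdeal K) (w.1.completionIdeal L)
      (v.completionIdeal_ne_bot K)]
  apply Ideal.ramificationIdx'_spec
  · rw [Ideal.map_le_iff_le_comap]
    intro x hx
    rw [mem_completionIdeal_iff'] at hx
    rw [Ideal.mem_comap, adicCompletion.mem_completionIdeal_pow, integer_algebraMap_apply,
      valued_adicCompletionSemialgHom]
    rw [WithZero.ofAdd_neg_ofNat_pow]
    apply pow_le_pow_left' hx
  · obtain ⟨ϖ, hϖ⟩ := adicCompletion.exists_uniformizer K v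
    have hϖ' : ϖ ∈ v.completionIdeal K := by
      rw [mem_completionIdeal_iff, hϖ]
      decide
    rw [Ideal.map_le_iff_le_comap]
    intro h
    have hcomap := h hϖ'
    rw [Ideal.mem_comap, adicCompletion.mem_completionIdeal_pow, integer_algebraMap_apply,
      valued_adicCompletionSemialgHom, hϖ, ← WithZero.ofAdd_neg_ofNat_pow,
      WithZero.coe_le_coe, Multiplicative.ofAdd_le] at hcomap
    simp at hcomap

/-- The local inertia degree of `L_w/K_v` equals the global inertia degree of `w/v`.
(In Mathlib's namespace `IsDedekindDomain.HeightOneSpectrum.adicCompletion`: a deliberate extension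
under FLT's name, for dot notation and so that the later packet files apply unchanged — CONVENTIONS §2.)
[cite: FLTProject2025, FLT/DedekindDomain/Completion/BaseChange.lean · IsDedekindDomain.HeightOneSpectrum.adicCompletion.inertiaDeg_eq_inertiaDeg] -/
theorem inertiaDeg_eq_inertiaDeg :
    w.1.asIdeal.inertiaDeg A =
      Ideal.inertiaDeg (w.1.completionIdeal L) (v.adicCompletionIntegers K) :=
  letI := Algebra.compHom (adicCompletionIntegers L w.1) (algebraMap A B)
  have : IsScalarTower A B (adicCompletionIntegers L w.1) :=
    IsScalarTower.of_algebraMap_eq fun _ ↦ rfl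
  have : IsScalarTower A (adicCompletionIntegers K v) (adicCompletionIntegers L w.1) := by
    apply IsScalarTower.of_algebraMap_eq
    intro x
    ext
    rw [Algebra.compHom_algebraMap_eq, RingHom.coe_comp, Function.comp_apply,
      algebraMap_completionIntegers, integer_algebraMap_apply, algebraMap_completionIntegers,
      IsScalarTower.algebraMap_apply B L (adicCompletion L w.1),
      ← IsScalarTower.algebraMap_apply A B L, IsScalarTower.algebraMap_apply A K L]
    symm
    apply SemialgHom.commutes
  have := liesOver_completionIdeal K L w
  -- Both sides are computed by comparing them with the inertia degree of `𝔪_w` over `A`, using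
  -- that inertia degrees are multiplicative in the towers `A ⊆ B ⊆ 𝒪_w` and `A ⊆ 𝒪_v ⊆ 𝒪_w`.
  calc w.1.asIdeal.inertiaDeg A
      = Ideal.inertiaDeg (w.1.completionIdeal L) A := by
        rw [Ideal.inertiaDeg_tower w.1.asIdeal (w.1.completionIdeal L),
          inertiaDeg_asIdeal_completionIdeal, mul_one]
    _ = Ideal.inertiaDeg (w.1.completionIdeal L) (v.adicCompletionIntegers K) := by
        rw [Ideal.inertiaDeg_tower (v.completionIdeal K) (w.1.completionIdeal L),
          inertiaDeg_asIdeal_completionIdeal, one_mul]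

/-- **`e(w ∣ v) · f(w ∣ v) = [L_w : K_v]`** for `w ∣ v` in the AKLB set-up: the product of the
(global) ramification index and inertia degree of `w` over `v` is the degree of the extension of
completions (Cassels–Fröhlich, Ch. II §10; here via `𝒪_w` module-finite free over the complete DVR
`𝒪_v` and `e`, `f` being unchanged by completion).
(In Mathlib's namespace `IsDedekindDomain.HeightOneSpectrum.adicCompletion`: a deliberate extension
under FLT's name, for dot notation and so that the later packet files apply unchanged — CONVENTIONS §2.)
[cite: FLTProject2025, FLT/DedekindDomain/Completion/BaseChange.lean · IsDedekindDomain.HeightOneSpectrum.adicCompletion.ramificationIdx_mul_inertiaDeg_eq_finrank] -/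
-- We use Ideal.ramificationIdx_mul_inertiaDeg_eq_finrank_of_isLocalRing here to show this, but we
-- could make use of the more general results in BGR:
-- - in general e * f <= degree (Prop 3.1.3.2)
-- - equality holds for L/K if L is K-cartesian (Prop 3.6.2.4)
-- - so for example if K is complete and discretely-valued (Cor 2.4.3.11).
theorem ramificationIdx_mul_inertiaDeg_eq_finrank [FiniteDimensional K L] [Module.Finite A B] :
    w.1.asIdeal.ramificationIdx A * w.1.asIdeal.inertiaDeg A =
      Module.finrank (adicCompletion K v) (adicCompletion L w.1) := by
  have : IsScalarTower (adicCompletionIntegers K v) (adicCompletionIntegers L w.1)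
      (adicCompletion L w.1) := .of_algebraMap_smul fun _ _ ↦ rfl
  have : IsScalarTower (adicCompletionIntegers K v) (adicCompletion K v) (adicCompletion L w.1) :=
    .of_algebraMap_smul fun _ _ ↦ rfl
  -- should any of these be more global instances?
  have : FaithfulSMul (adicCompletionIntegers K v) (adicCompletionIntegers L w.1) :=
    FaithfulSMul.of_field_isFractionRing _ _ (adicCompletion K v) (adicCompletion L w.1)
  -- (FLT: `IsFractionRing.finrank_eq` of its newer Mathlib; at this pin the same statement is
  -- `Algebra.IsAlgebraic.finrank_of_isFractionRing`)
  rw [Algebra.IsAlgebraic.finrank_of_isFractionRing (adicCompletionIntegers K v) (adicCompletion K v)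
      (adicCompletionIntegers L w.1) (adicCompletion L w.1),
    ← Ideal.ramificationIdx_mul_inertiaDeg_eq_finrank_of_isLocalRing (adicCompletionIntegers L w.1)
      (p := v.completionIdeal K) (v.completionIdeal_ne_bot K),
    ramificationIdx_eq_ramificationIdx, inertiaDeg_eq_inertiaDeg K L w]

end RamificationInertia

variable [FiniteDimensional K L] [Module.Finite A B] (B)
variable (v : HeightOneSpectrum A) (w : v.Extension B)

open scoped TensorProduct.RightActions in
/-- `L ⊗[K] K_v` and `∏_{w|v} L_w` have equal dimensions
(In Mathlib's namespace `IsDedekindDomain.HeightOneSpectrum.adicCompletion`: a deliberate extension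
under FLT's name, for dot notation and so that the later packet files apply unchanged — CONVENTIONS §2.)
[cite: FLTProject2025, FLT/DedekindDomain/Completion/BaseChange.lean · IsDedekindDomain.HeightOneSpectrum.adicCompletion.finrank_tensorProduct_adicCompletion_eq_finrank_pi_adicCompletion] -/
lemma finrank_tensorProduct_adicCompletion_eq_finrank_pi_adicCompletion :
    Module.finrank (adicCompletion K v) (L ⊗[K] adicCompletion K v) =
      Module.finrank (adicCompletion K v) ((w : Extension B v) → adicCompletion L w.val) :=
  letI := Extension.fintype A K L B v
  calc Module.finrank (adicCompletion K v) (L ⊗[K] adicCompletion K v)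
    _ = Module.finrank K L := by rw [TensorProduct.finrank_rightAlgebra]
    _ = ∑ (w : Extension B v), w.val.asIdeal.ramificationIdx A * w.val.asIdeal.inertiaDeg A := by
        rw [Ideal.sum_ramification_inertia_extensions]
    _ = ∑ (w : Extension B v), Module.finrank (adicCompletion K v) (adicCompletion L w.val) :=
        Finset.sum_congr rfl fun w _ ↦ ramificationIdx_mul_inertiaDeg_eq_finrank K L w
    _ = Module.finrank (adicCompletion K v) ((w : Extension B v) → adicCompletion L w.val) := by
        rw [Module.finrank_pi_fintype (adicCompletion K v)]

open scoped TensorProduct.RightActions in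
/-- The canonical map `L ⊗[K] K_v → ∏_{w|v} L_w` is bijective.
(In Mathlib's namespace `IsDedekindDomain.HeightOneSpectrum.adicCompletion`: a deliberate extension
under FLT's name, for dot notation and so that the later packet files apply unchanged — CONVENTIONS §2.)
[cite: FLTProject2025, FLT/DedekindDomain/Completion/BaseChange.lean · IsDedekindDomain.HeightOneSpectrum.adicCompletion.baseChange_bijective] -/
theorem baseChange_bijective : Function.Bijective (baseChange K L B v) := by
  change Function.Bijective (baseChangeRight K L B v)
  have hsurj := baseChangeRight_surjective K L B v
  refine ⟨?_, hsurj⟩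
  have hrank := finrank_tensorProduct_adicCompletion_eq_finrank_pi_adicCompletion K L B v
  rwa [← AlgHom.coe_toLinearMap, LinearMap.injective_iff_surjective_of_finrank_eq_finrank hrank]

/-- **Local base change (T1).** The `L`-algebra isomorphism `L ⊗[K] K_v ≅ ∏_{w|v} L_w` for a
finite extension `L/K` of fraction fields of Dedekind domains `B/A` and a nonzero prime `v` of `A`
— Cassels–Fröhlich, Ch. II (Cassels, *Global fields*) §10, Theorem, display (10.2)
"`k̄ ⊗_k K = ⊕_j K_j` algebraically and topologically". Lean statement and proof: the FLT project,
`FLT/DedekindDomain/Completion/BaseChange.lean` · `IsDedekindDomain.HeightOneSpectrum.adicCompletion.baseChangeAlgEquiv`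
[FLTProject2025] (bijectivity of `baseChange K L B v`: surjective by density of `L` in `∏ L_w`
and closedness of the image, dimensions equal by `Σ e f = [L : K]`).
(In Mathlib's namespace `IsDedekindDomain.HeightOneSpectrum.adicCompletion`: a deliberate extension
under FLT's name, for dot notation and so that the later packet files apply unchanged — CONVENTIONS §2.)
[cite: CasselsFrohlichANT1967, Ch. II §10 Theorem (10.2)] -/
noncomputable def baseChangeAlgEquiv :
    L ⊗[K] v.adicCompletion K ≃ₐ[L] Π w : v.Extension B, w.1.adicCompletion L :=
  AlgEquiv.ofBijective (baseChange K L B v) <| baseChange_bijective K L B v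

set_option backward.isDefEq.respectTransparency false in
open scoped TensorProduct.RightActions in
/-- **Local base change, topological form (T1).** The `L`-algebra HOMEOMORPHISM
`L ⊗[K] K_v ≃A[L] ∏_{w|v} L_w`, `L ⊗[K] K_v` carrying the `K_v`-module topology — the
"and topologically" clause of Cassels–Fröhlich, Ch. II §10, Theorem (10.2). Lean statement and proof:
the FLT project, `FLT/DedekindDomain/Completion/BaseChange.lean` ·
`IsDedekindDomain.HeightOneSpectrum.adicCompletion.baseChangeContinuousAlgEquiv` [FLTProject2025]
(from `baseChangeAlgEquiv` by `IsModuleTopology.continuousAlgEquivOfIsBiscalar`).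
(In Mathlib's namespace `IsDedekindDomain.HeightOneSpectrum.adicCompletion`: a deliberate extension
under FLT's name, for dot notation and so that the later packet files apply unchanged — CONVENTIONS §2.)
[cite: CasselsFrohlichANT1967, Ch. II §10 Theorem (10.2), topological clause] -/
noncomputable def baseChangeContinuousAlgEquiv :
    L ⊗[K] v.adicCompletion K ≃A[L] Π w : v.Extension B, w.1.adicCompletion L :=
  have : IsBiscalar L (v.adicCompletion K) (baseChangeAlgEquiv K L B v).toAlgHom :=
    inferInstanceAs (IsBiscalar L (v.adicCompletion K) (baseChange K L B v))
  IsModuleTopology.continuousAlgEquivOfIsBiscalar (v.adicCompletion K)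
    (baseChangeAlgEquiv K L B v)

/-- The `B`-module isomorphism `B ⊗[A] K_v ≅ ∏_{w|v} L_w`.
(In Mathlib's namespace `IsDedekindDomain.HeightOneSpectrum.adicCompletion`: a deliberate extension
under FLT's name, for dot notation and so that the later packet files apply unchanged — CONVENTIONS §2.)
[cite: FLTProject2025, FLT/DedekindDomain/Completion/BaseChange.lean · IsDedekindDomain.HeightOneSpectrum.adicCompletion.integerBaseChangeLinearEquiv] -/
noncomputable def integerBaseChangeLinearEquiv :
    B ⊗[A] v.adicCompletion K ≃ₗ[B] ∀ w : v.Extension B, w.1.adicCompletion L :=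
  (linearEquivTensorProductModuleLeft A K L B (v.adicCompletion K)).symm.trans
    ((baseChangeAlgEquiv K L B v).toLinearEquiv.restrictScalars B)

/-- `integerBaseChangeLinearEquiv K L B v (b ⊗ₜ x) w = algebraMap B L_w b * algebraMap K_v L_w x`.
(In Mathlib's namespace `IsDedekindDomain.HeightOneSpectrum.adicCompletion`: a deliberate extension
under FLT's name, for dot notation and so that the later packet files apply unchanged — CONVENTIONS §2.)
[cite: FLTProject2025, FLT/DedekindDomain/Completion/BaseChange.lean · IsDedekindDomain.HeightOneSpectrum.adicCompletion.integerBaseChangeLinearEquiv_tmul_apply] -/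
@[simp]
lemma integerBaseChangeLinearEquiv_tmul_apply (b x) :
    integerBaseChangeLinearEquiv K L B v (b ⊗ₜ[A] x) w =
      algebraMap B _ b * algebraMap _ _ x := by
  rw [integerBaseChangeLinearEquiv, LinearEquiv.trans_apply,
    linearEquivTensorProductModuleLeft_symm_tmul]
  rfl

/-- `𝓞_v` as an `A`-submodule of `K_v`.
(In Mathlib's namespace `IsDedekindDomain.HeightOneSpectrum.adicCompletion`: a deliberate extension
under FLT's name, for dot notation and so that the later packet files apply unchanged — CONVENTIONS §2.)
[cite: FLTProject2025, FLT/DedekindDomain/Completion/BaseChange.lean · IsDedekindDomain.HeightOneSpectrum.adicCompletion.integerSubmodule] -/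
noncomputable def integerSubmodule (v : HeightOneSpectrum A) : Submodule A (adicCompletion K v) :=
  let s : Submodule (adicCompletionIntegers K v) _ := (adicCompletionIntegers K v).toSubmodule
  s.restrictScalars A

end adicCompletion

namespace adicCompletionIntegers

open adicCompletion

variable (B)

/-- The canonical `B`-linear map `B ⊗[A] 𝓞_v → B ⊗[A] K_v`.
(In Mathlib's namespace `IsDedekindDomain.HeightOneSpectrum.adicCompletionIntegers`: a deliberate
extension under FLT's name, for dot notation and so that the later packet files apply unchanged — CONVENTIONS §2.)
[cite: FLTProject2025, FLT/DedekindDomain/Completion/BaseChange.lean · IsDedekindDomain.HeightOneSpectrum.adicCompletionIntegers.tensorCoe] -/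
noncomputable def tensorCoe : B ⊗[A] v.adicCompletionIntegers K →ₗ[B] B ⊗[A] v.adicCompletion K :=
  TensorProduct.AlgebraTensorModule.lTensor _ _
    (Algebra.algHom A (adicCompletionIntegers K v) (adicCompletion K v)).toLinearMap

omit [Algebra.IsIntegral A B] [IsDedekindDomain B] in
/-- `adicCompletionIntegers.tensorCoe K B v (b ⊗ₜ x) = b ⊗ₜ ↑x`.
(In Mathlib's namespace `IsDedekindDomain.HeightOneSpectrum.adicCompletionIntegers`: a deliberate
extension under FLT's name, for dot notation and so that the later packet files apply unchanged — CONVENTIONS §2.)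
[cite: FLTProject2025, FLT/DedekindDomain/Completion/BaseChange.lean · IsDedekindDomain.HeightOneSpectrum.adicCompletionIntegers.tensorCoe_tmul] -/
@[simp]
lemma tensorCoe_tmul (b : B) (x : v.adicCompletionIntegers K) :
    tensorCoe K B v (b ⊗ₜ x) = b ⊗ₜ x.val := rfl

end adicCompletionIntegers

namespace adicCompletion

open Extension

variable [FiniteDimensional K L] [Module.Finite A B]

/-- **Integral base change**: the isomorphism `B ⊗[A] K_v ≅ ∏_{w∣v} L_w` maps (the image of) `B
⊗[A] 𝒪_v` bijectively onto `∏_{w∣v} 𝒪_w` — i.e. `B ⊗[A] 𝒪_v ≅ ∏_{w∣v} 𝒪_w` (Cassels–Fröhlich, Ch.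
II §10–§11; the ingredient that makes `L ⊗ 𝔸_K^∞ → 𝔸_L^∞` respect the restricted product).
(In Mathlib's namespace `IsDedekindDomain.HeightOneSpectrum.adicCompletion`: a deliberate extension
under FLT's name, for dot notation and so that the later packet files apply unchanged — CONVENTIONS §2.)
[cite: FLTProject2025, FLT/DedekindDomain/Completion/BaseChange.lean · IsDedekindDomain.HeightOneSpectrum.adicCompletion.integerBaseChangeLinearEquiv_bijOn] -/
theorem integerBaseChangeLinearEquiv_bijOn (v : HeightOneSpectrum A) :
    Set.BijOn (integerBaseChangeLinearEquiv K L B v)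
      (Set.range (adicCompletionIntegers.tensorCoe K B v))
      (Submodule.pi Set.univ fun (w : Extension B v) ↦ integerSubmodule L w.val) := by
  suffices h : ((integerBaseChangeLinearEquiv K L B v) ''
      (LinearMap.range (adicCompletionIntegers.tensorCoe K B v))) =
      Submodule.pi .univ fun (w : Extension B v) ↦ (integerSubmodule L w.val).restrictScalars A from
    h ▸ Equiv.bijOn_image (integerBaseChangeLinearEquiv K L B v).toEquiv
  apply Eq.trans _ (range_baseChange_comp_tensorAdicCompletionTo_eq_pi K L B v)
  rw [LinearMap.coe_range, ← Set.range_comp, ← LinearEquiv.coe_toLinearMap, ← LinearMap.coe_comp]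
  rw [← AlgHom.coe_restrictScalars' B (baseChange K L B v), ← AlgHom.coe_comp,
    ← AlgHom.coe_toLinearMap]
  congr
  ext
  simp [baseChange_tmul_apply]

end IsDedekindDomain.HeightOneSpectrum.adicCompletion

end
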